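import Literature.AlgebraicGeometry.HodgeTheory.WeilClassesFieldCentreInSubfield
import Literature.AlgebraicGeometry.HodgeTheory.WeilClassesFieldEvenRankOfNoTypeIVFactor
import HarnessLib

/-!
# No factor of type IV ⟺ every central endomorphism has real spectrum on `H¹(A(ℂ); ℂ)` — the tree's
# `HasNoTypeIVFactor` read on the carrier through the faithful rational representation

Layer `Literature/AlgebraicGeometry/HodgeTheory`, theorem-only (no definition, no named fact, no `sorry`).

THE PREDICATE AND ITS PRINTED MEANING.  The tree's `HodgeTheory.HasNoTypeIVFactor A` (`HodgeGroupProductCMFactor`) renders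
«all simple factors of `X` are of type 1, 2 or 3 in the Albert classification» (Moonen–Zarhin 1998, §1, second Remark after
the Criterion; Moonen–Zarhin 1999 §1 «no factors of Type 4») as: every element `z` of the centre `Z(End⁰(A))` is killed by
a non-zero rational polynomial all of whose complex roots are real (the centre is a product of totally real fields —
Lange–Birkenhake §5.5: the centre of `End⁰` of a simple abelian variety is totally real for types I–III and a CM field for
type IV).  The tree PROVES one half of its reading on the carrier (`HodgeGroupSemisimpleOfNoTypeIVFactor.conj_eigenvalue_
pullbackOne`: under `HasNoTypeIVFactor`, a pull-back `u^*` in Milne's centraliser `C(A) ⊗ ℂ` has only real eigenvalues on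
`H¹(A(ℂ); ℂ)`).  This file proves the CONVERSE and states the equivalence, through the faithful rational representation
(Lange–Birkenhake §1.2 Prop. 1.2.3; Mumford §19 Thm. 3: `End(X) ⊂ End⁰(X)`): the characteristic polynomial of `F^*` on `H¹`
is rational (the tree's `exists_charpoly_map_one_eq_map`), Cayley–Hamilton transports to `End⁰(A)`, and its roots are the
eigenvalues of `F^*`.

WHAT IS PROVED (`A` a complex abelian variety).
* §1 `pullbackOne_mem_centralizerAlgebra_of_endAlgebra_of_mem_center` — `1 ⊗ F ∈ Z(End⁰ A)` ⟹ `F^* ∈ C(A) ⊗ ℂ` (with the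
  seat's `endAlgebra_of_mem_center_of_pullbackOne_mem_centralizerAlgebra`: an `iff`,
  `pullbackOne_mem_centralizerAlgebra_iff_endAlgebra_of_mem_center`);
  **`aeval_endAlgebra_of_eq_zero_of_charpoly_eq_map`** — CAYLEY–HAMILTON IN `End⁰(A)`: if `χ ∈ ℚ[T]` maps to the
  characteristic polynomial of `F^*` on `H¹(A(ℂ); ℂ)`, then `χ(1 ⊗ F) = 0` in `End⁰(A)` (clear denominators, `χ_ℤ(F)` acts by
  `b · χ(F^*) = 0` on `H¹`, the complex representation is faithful, `End(A) ↪ End⁰(A)`).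
* §2 **`hasNoTypeIVFactor_of_forall_hasEigenvalue_im_eq_zero`** — if every pull-back `u^* ∈ C(A) ⊗ ℂ` has only real
  eigenvalues on `H¹(A(ℂ); ℂ)`, then `HasNoTypeIVFactor A` (for `z = M⁻¹ (1 ⊗ F)` central: `F^* ∈ C(A) ⊗ ℂ`, and
  `f(T) = χ_F(M T) ∈ ℚ[T]` is non-zero, kills `z`, and has only real roots);
  **`hasNoTypeIVFactor_iff_forall_hasEigenvalue_im_eq_zero`** — THE EQUIVALENCE (the other half is the tree's
  `conj_eigenvalue_pullbackOne`); `hasNoTypeIVFactor_iff_forall_comp_comm_hasEigenvalue_im_eq_zero` — the same with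
  «`u^* ∈ C(A) ⊗ ℂ`» replaced by «`u` central in `End(A)`» (the seat's dictionary).
* §3 riders: `exists_central_hasEigenvalue_im_ne_zero_of_odd` — with the seat's `not_hasNoTypeIVFactor_of_odd` (Moonen–Zarhin
  §2 Example: `2 dim(Y)/[F:ℚ]` odd): if `End(A) ∋ φ` with `P(φ) = 0`, `P` monic irreducible of degree `e`, `e · r = 2 dim A`,
  `r` ODD, then some CENTRAL endomorphism `u` of `A` has a NON-REAL eigenvalue on `H¹(A(ℂ); ℂ)` (a factor of type IV made
  visible on the carrier); `exists_central_hasEigenvalue_im_ne_zero_of_natDegree_eq_two_mul_dim` — in particular under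
  multiplication by a field of degree `2 dim A`.

Honesty clause: a dictionary between the tree's predicate and the carrier; no classification of endomorphism algebras is
used or claimed, «central» is literal commutation in `End(A)`, and no isogeny decomposition is chosen.
No `sorry`; axioms `propext`, `Classical.choice`, `Quot.sound`.

## References
* [LangeBirkenhake1992] H. Lange, Ch. Birkenhake, *Complex Abelian Varieties*, §1.2 Prop. 1.2.3 (the rational and analytic
  representations are faithful; `ρ_a ⊕ ρ̄_a ≃ ρ_r ⊗ ℂ`), §5.5 (Albert types; Prop. 5.5.7).
* [MumfordAV1970] D. Mumford, *Abelian Varieties*, §19 Thm. 3 and Cor. 2 (`End(X) ⊂ End⁰(X)`; the characteristic polynomial).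
* [MoonenZarhin1998WeilClasses] B. J. J. Moonen, Yu. G. Zarhin, *Weil classes on abelian varieties*, J. reine angew. Math.
  496 (1998), §1 second Remark after the Criterion, §2 Example (chunk p0002).
* [MoonenZarhin1999LowDim] B. Moonen, Yu. Zarhin, Math. Ann. 315 (1999), §1 («no factors of Type 4»).
-/

noncomputable section

open CategoryTheory Polynomial Module

namespace Literature.AlgebraicGeometry.HodgeTheory

open Literature.AlgebraicTopology.SingularHomology
open Literature.AlgebraicGeometry.Motives
open Literature.AlgebraicGeometry.VanGeemen1994 (pullbackOne)
open Literature.AlgebraicGeometry.Milne1999 (centralizerAlgebra mem_centralizerAlgebra_iff)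

section HodgeTheory

variable {A : AbelianVariety ℂ}

/-! ### §1 Central elements of `End⁰(A)` and Cayley–Hamilton in `End⁰(A)` -/

section Dictionary

/-- **`1 ⊗ F ∈ Z(End⁰ A)` ⟹ `F^* ∈ C(A) ⊗ ℂ`**: `(1 ⊗ F)(1 ⊗ G) = (1 ⊗ G)(1 ⊗ F)` and `End(A) ↪ End⁰(A)` (Mumford §19 Thm. 3)
give `F G = G F` in `End(A)`, so `F^*` commutes with every `G^*`. [cite: MumfordAV1970, §19 Thm. 3]
[cite: Milne1999LefschetzClasses, §1 p. 642 (`C(A)`)] -/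
theorem pullbackOne_mem_centralizerAlgebra_of_endAlgebra_of_mem_center {F : A ⟶ A}
    (hF : AbelianVariety.endAlgebra.of A F ∈ Subalgebra.center ℚ A.endAlgebra) :
    pullbackOne A F ∈ centralizerAlgebra A := by
  refine pullbackOne_mem_centralizerAlgebra_of_comp_comm fun φ => ?_
  have h : AbelianVariety.endAlgebra.of A (End.of F * End.of φ) = AbelianVariety.endAlgebra.of A (End.of φ * End.of F) := by
    rw [map_mul, map_mul]
    exact (Subalgebra.mem_center_iff.1 hF _).symm
  have h' : End.of F * End.of φ = End.of φ * End.of F := AbelianVariety.endAlgebra.of_injective_of_charZero (A := A) h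
  rw [End.mul_def, End.mul_def] at h'
  exact h'

/-- **`F^* ∈ C(A) ⊗ ℂ` iff `1 ⊗ F` is central in `End⁰(A)`.** [cite: MumfordAV1970, §19 Thm. 3]
[cite: LangeBirkenhake1992, §1.2 Prop. 1.2.3] -/
theorem pullbackOne_mem_centralizerAlgebra_iff_endAlgebra_of_mem_center {F : A ⟶ A} :
    pullbackOne A F ∈ centralizerAlgebra A ↔ AbelianVariety.endAlgebra.of A F ∈ Subalgebra.center ℚ A.endAlgebra :=
  ⟨endAlgebra_of_mem_center_of_pullbackOne_mem_centralizerAlgebra,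
    pullbackOne_mem_centralizerAlgebra_of_endAlgebra_of_mem_center⟩

/-- **CAYLEY–HAMILTON IN `End⁰(A)`**: if `χ ∈ ℚ[T]` maps to the characteristic polynomial of `F^*` on `H¹(A(ℂ); ℂ)` (such a
`χ` exists, monic of degree `2 dim A`: the tree's `exists_charpoly_map_one_eq_map` — the rational representation), then
`χ(1 ⊗ F) = 0` in `End⁰(A)`: with `χ_ℤ = b χ ∈ ℤ[T]` (`b ≠ 0`), `χ_ℤ(F) ∈ End(A)` acts on `H¹` by `b · χ(F^*) = 0`
(Cayley–Hamilton for `F^*`), hence `χ_ℤ(F) = 0` (the complex representation is faithful) and `b · χ(1 ⊗ F) = 0`.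
[cite: LangeBirkenhake1992, §1.2 Prop. 1.2.3] [cite: MumfordAV1970, §19 Thm. 3 and Thm. 4 (the characteristic polynomial)] -/
theorem aeval_endAlgebra_of_eq_zero_of_charpoly_eq_map [Module.Finite ℂ (complexBetti A.X 1)] (F : A ⟶ A) {χ : ℚ[X]}
    (hχ : (pullbackOne A F).charpoly = χ.map (algebraMap ℚ ℂ)) :
    aeval (AbelianVariety.endAlgebra.of A F) χ = 0 := by
  -- clear denominators: `χ_ℤ ↦ b χ`
  set χz : Polynomial ℤ := IsLocalization.integerNormalization (nonZeroDivisors ℤ) χ with hχz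
  obtain ⟨b, hbM, hb⟩ := IsLocalization.integerNormalization_spec (nonZeroDivisors ℤ) χ
  rw [← hχz, ← algebraMap_smul ℚ b χ, Polynomial.smul_eq_C_mul] at hb
  have hb0 : b ≠ 0 := nonZeroDivisors.ne_zero hbM
  -- `Y = χ_ℤ(F) ∈ End(A)` acts by `b · χ(F^*) = 0` on `H¹`
  set Y : CategoryTheory.End A := Polynomial.eval₂ (Int.castRingHom (CategoryTheory.End A)) (End.of F) χz with hYdef
  have hmapC : χz.map (Int.castRingHom ℂ) = Polynomial.C (b : ℂ) * χ.map (algebraMap ℚ ℂ) := by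
    have h1 : (χz.map (algebraMap ℤ ℚ)).map (algebraMap ℚ ℂ) = χz.map (Int.castRingHom ℂ) := by
      rw [Polynomial.map_map]
      exact congrArg (fun g : ℤ →+* ℂ => χz.map g) (RingHom.ext_int _ _)
    rw [← h1, hb, Polynomial.map_mul, Polynomial.map_C, eq_intCast, map_intCast]
  have hYH : (complexBetti.map (End.asHom Y).hom.hom.hom 1).hom = 0 := by
    rw [hom_complexBetti_map_one_of_eq_eval₂ (φ := F) (ψ := End.asHom Y) (S := χz) hYdef, hmapC, map_mul,
      Polynomial.aeval_C, ← hχ]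
    change algebraMap ℂ _ (b : ℂ) * aeval (pullbackOne A F) (pullbackOne A F).charpoly = 0
    rw [LinearMap.aeval_self_charpoly, mul_zero]
  have hY0 : End.asHom Y = 0 := ComplexMultiplication.hom_eq_zero_of_complexBetti_map_one_eq_zero _ hYH
  -- transport to `End⁰(A)`: `b · χ(1 ⊗ F) = 0`
  have hE : algebraMap ℚ A.endAlgebra (b : ℚ) * aeval (AbelianVariety.endAlgebra.of A F) χ = 0 := by
    have h := congrArg (AbelianVariety.endAlgebra.of A) hY0
    change AbelianVariety.endAlgebra.of A (Polynomial.eval₂ (Int.castRingHom (CategoryTheory.End A)) (End.of F) χz) =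
      AbelianVariety.endAlgebra.of A (0 : CategoryTheory.End A) at h
    rw [map_zero, Polynomial.hom_eval₂,
      RingHom.ext_int ((AbelianVariety.endAlgebra.of A).comp (Int.castRingHom (CategoryTheory.End A)))
        ((algebraMap ℚ A.endAlgebra).comp (algebraMap ℤ ℚ)),
      ← Polynomial.eval₂_map, hb, ← Polynomial.aeval_def, map_mul, Polynomial.aeval_C, eq_intCast] at h
    exact h
  rw [← Algebra.smul_def, smul_eq_zero] at hE
  exact hE.resolve_left (by exact_mod_cast hb0)

end Dictionary

/-! ### §2 `HasNoTypeIVFactor A` ⟺ central pull-backs have only real eigenvalues on `H¹(A(ℂ); ℂ)` -/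

section RealSpectrum

/-- **REAL SPECTRUM OF CENTRAL PULL-BACKS ⟹ NO FACTOR OF TYPE IV.**  If every pull-back `u^*` lying in Milne's centraliser
`C(A) ⊗ ℂ` (equivalently: `u` central in `End(A)`) has only REAL eigenvalues on `H¹(A(ℂ); ℂ)`, then `HasNoTypeIVFactor A`:
a central `z ∈ End⁰(A)` is `M⁻¹ (1 ⊗ F)` with `F` central in `End(A)`; the rational characteristic polynomial `χ_F` of `F^*`
kills `1 ⊗ F` (Cayley–Hamilton in `End⁰(A)`, §1), so `f(T) = χ_F(M T) ∈ ℚ[T]` is non-zero and kills `z`, and a complex root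
`x` of `f` has `M x` an eigenvalue of `F^*`, hence real. [cite: LangeBirkenhake1992, §1.2 Prop. 1.2.3 and §5.5]
[cite: MumfordAV1970, §19 Thm. 3] [cite: MoonenZarhin1999LowDim, §1] -/
theorem hasNoTypeIVFactor_of_forall_hasEigenvalue_im_eq_zero
    (h : ∀ u : A ⟶ A, pullbackOne A u ∈ centralizerAlgebra A →
      ∀ μ : ℂ, (pullbackOne A u).HasEigenvalue μ → μ.im = 0) :
    HasNoTypeIVFactor A := by
  classical
  haveI := finite_complexBetti_abelianVariety A 1
  intro z hz
  obtain ⟨M, F, hM, rfl⟩ := AbelianVariety.endAlgebra.exists_eq_algebraMap_mul_of z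
  have hM' : (M : ℚ) ≠ 0 := Nat.cast_ne_zero.2 hM
  -- `1 ⊗ F = M · z` is central, so `F^* ∈ C(A) ⊗ ℂ`
  have hofF : AbelianVariety.endAlgebra.of A F =
      algebraMap ℚ A.endAlgebra (M : ℚ) * (algebraMap ℚ A.endAlgebra (M : ℚ)⁻¹ * AbelianVariety.endAlgebra.of A F) := by
    rw [← mul_assoc, ← map_mul, mul_inv_cancel₀ hM', map_one, one_mul]
  have hFc : AbelianVariety.endAlgebra.of A F ∈ Subalgebra.center ℚ A.endAlgebra := by
    rw [hofF]
    exact Subalgebra.mul_mem _ (Subalgebra.algebraMap_mem _ _) hz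
  have hFC : pullbackOne A F ∈ centralizerAlgebra A := pullbackOne_mem_centralizerAlgebra_of_endAlgebra_of_mem_center hFc
  -- the rational characteristic polynomial of `F^*`
  obtain ⟨χ, hχm, -, hχ⟩ := exists_charpoly_map_one_eq_map F
  have hχF : aeval (AbelianVariety.endAlgebra.of A F) χ = 0 := aeval_endAlgebra_of_eq_zero_of_charpoly_eq_map F hχ
  -- `f(T) = χ(M T)`
  refine ⟨χ.comp (Polynomial.C (M : ℚ) * X), fun hf => ?_, ?_, fun x hx => ?_⟩
  · -- `f ≠ 0`
    rcases Polynomial.comp_eq_zero_iff.1 hf with h0 | ⟨-, hq⟩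
    · exact hχm.ne_zero h0
    · have hq' := congrArg (fun p : ℚ[X] => p.coeff 1) hq
      simp only [Polynomial.coeff_C_mul, Polynomial.coeff_X_one, mul_one, Polynomial.coeff_C, one_ne_zero,
        if_false] at hq'
      exact hM' hq'
  · -- `f(z) = χ(1 ⊗ F) = 0`
    rw [Polynomial.aeval_comp, map_mul, Polynomial.aeval_C, Polynomial.aeval_X, ← hofF]
    exact hχF
  · -- a root `x` of `f` has `M x` an eigenvalue of `F^*`
    rw [Polynomial.aeval_comp, map_mul, Polynomial.aeval_C, Polynomial.aeval_X] at hx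
    have hroot : (pullbackOne A F).charpoly.IsRoot (algebraMap ℚ ℂ (M : ℚ) * x) := by
      rw [hχ, Polynomial.IsRoot.def, Polynomial.eval_map, ← Polynomial.aeval_def]
      exact hx
    have hev := (Module.End.hasEigenvalue_iff_isRoot_charpoly _ _).2 hroot
    have him := h F hFC _ hev
    rw [map_natCast, Complex.mul_im, Complex.natCast_re, Complex.natCast_im, zero_mul, add_zero] at him
    exact (mul_eq_zero.1 him).resolve_left (Nat.cast_ne_zero.2 hM)

/-- **NO FACTOR OF TYPE IV ⟺ EVERY CENTRAL PULL-BACK HAS REAL SPECTRUM ON `H¹(A(ℂ); ℂ)`** — the tree's predicate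
`HasNoTypeIVFactor A` (the centre of `End⁰(A)` is elementwise totally real) read on the carrier: for every `u ∈ End(A)`
with `u^* ∈ C(A) ⊗ ℂ` and every eigenvalue `μ` of `u^*` on `H¹(A(ℂ); ℂ)`, `μ ∈ ℝ` («⟹» is the tree's
`conj_eigenvalue_pullbackOne`; «⟸» the previous theorem). [cite: LangeBirkenhake1992, §1.2 Prop. 1.2.3 and §5.5 (the centre
of `End⁰` is totally real for types I–III, a CM field for type IV)] [cite: MoonenZarhin1999LowDim, §1] -/
theorem hasNoTypeIVFactor_iff_forall_hasEigenvalue_im_eq_zero :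
    HasNoTypeIVFactor A ↔ ∀ u : A ⟶ A, pullbackOne A u ∈ centralizerAlgebra A →
      ∀ μ : ℂ, (pullbackOne A u).HasEigenvalue μ → μ.im = 0 := by
  refine ⟨fun hA4 u huC μ hμ => ?_, hasNoTypeIVFactor_of_forall_hasEigenvalue_im_eq_zero⟩
  obtain ⟨v, hv⟩ := hμ.exists_hasEigenvector
  exact Complex.conj_eq_iff_im.1 (HodgeGroupSemisimple.conj_eigenvalue_pullbackOne hA4 u huC hv.2 hv.apply_eq_smul)

/-- **The same with «`u` central in `End(A)`» in place of «`u^* ∈ C(A) ⊗ ℂ`»** (the seat's dictionary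
`comp_comm_of_pullbackOne_mem_centralizerAlgebra` / `pullbackOne_mem_centralizerAlgebra_of_comp_comm`).
[cite: LangeBirkenhake1992, §1.2 Prop. 1.2.3 and §5.5] [cite: MoonenZarhin1999LowDim, §1] -/
theorem hasNoTypeIVFactor_iff_forall_comp_comm_hasEigenvalue_im_eq_zero :
    HasNoTypeIVFactor A ↔ ∀ u : A ⟶ A, (∀ φ : A ⟶ A, φ ≫ u = u ≫ φ) →
      ∀ μ : ℂ, (pullbackOne A u).HasEigenvalue μ → μ.im = 0 := by
  rw [hasNoTypeIVFactor_iff_forall_hasEigenvalue_im_eq_zero]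
  exact ⟨fun h u hu => h u (pullbackOne_mem_centralizerAlgebra_of_comp_comm hu),
    fun h u huC => h u (comp_comm_of_pullbackOne_mem_centralizerAlgebra huC)⟩

end RealSpectrum

/-! ### §3 Riders: a factor of type IV made visible on `H¹` -/

section Riders

variable {φ : A ⟶ A} {P : Polynomial ℤ} {e r : ℕ}

/-- **THE §2 EXAMPLE'S FACTORS, ON THE CARRIER: `2 dim A/[F:ℚ]` ODD ⟹ SOME CENTRAL ENDOMORPHISM HAS A NON-REAL EIGENVALUE ON
`H¹(A(ℂ); ℂ)`** (`P ∈ ℤ[T]` monic irreducible of degree `e`, `P(φ) = 0`, `e · r = 2 dim A`, `r` odd: the seat's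
`not_hasNoTypeIVFactor_of_odd` with §2). [cite: MoonenZarhin1998WeilClasses, §2 Example (chunk p0002) with §1 second Remark]
[cite: LangeBirkenhake1992, §5.5] -/
theorem exists_central_hasEigenvalue_im_ne_zero_of_odd (hPm : P.Monic) (hPe : P.natDegree = e)
    (hPirr : Irreducible (P.map (Int.castRingHom ℚ)))
    (hφ : Polynomial.eval₂ (Int.castRingHom (CategoryTheory.End A)) (φ : CategoryTheory.End A) P = 0)
    (her : e * r = 2 * A.dim) (hr : Odd r) :
    ∃ (u : A ⟶ A) (μ : ℂ), (∀ ψ : A ⟶ A, ψ ≫ u = u ≫ ψ) ∧ (pullbackOne A u).HasEigenvalue μ ∧ μ.im ≠ 0 := by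
  have h := not_hasNoTypeIVFactor_of_odd hPm hPe hPirr hφ her hr
  rw [hasNoTypeIVFactor_iff_forall_comp_comm_hasEigenvalue_im_eq_zero] at h
  push Not at h
  obtain ⟨u, hu, μ, hμ, him⟩ := h
  exact ⟨u, μ, hu, hμ, him⟩

/-- **In particular: multiplication by a field of degree `2 dim A` (`P` monic irreducible of degree `2 dim A`, `P(φ) = 0`)
forces a central endomorphism with a non-real eigenvalue on `H¹(A(ℂ); ℂ)`.**
[cite: MoonenZarhin1998WeilClasses, §1 second Remark after the Criterion and Criterion (2), first sentence]
[cite: LangeBirkenhake1992, §5.5] -/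
theorem exists_central_hasEigenvalue_im_ne_zero_of_natDegree_eq_two_mul_dim (hPm : P.Monic)
    (hPe : P.natDegree = 2 * A.dim) (hPirr : Irreducible (P.map (Int.castRingHom ℚ)))
    (hφ : Polynomial.eval₂ (Int.castRingHom (CategoryTheory.End A)) (φ : CategoryTheory.End A) P = 0) :
    ∃ (u : A ⟶ A) (μ : ℂ), (∀ ψ : A ⟶ A, ψ ≫ u = u ≫ ψ) ∧ (pullbackOne A u).HasEigenvalue μ ∧ μ.im ≠ 0 :=
  exists_central_hasEigenvalue_im_ne_zero_of_odd (r := 1) hPm hPe hPirr hφ (Nat.mul_one _) odd_one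

end Riders

end HodgeTheory

end Literature.AlgebraicGeometry.HodgeTheory

end
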